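import Summits.Langlands.Langlands.Theses.DegenerateLimits
import Literature.NumberTheory.Automorphic.UnitaryCoherentGaloisRep
import Literature.NumberTheory.GaloisRepresentations.HeckeCharacter

/-!
# Birth skeleton (BC3) for crux stmt-Langlands-2629
`Summit.Langlands.Langlands.Theses.DegenerateLimits.CongruencesToRegular` — line `birth`

Route `route-Langlands-DegenerateLimits` (crux rank 2, the HEART). The crux: a cuspidal `π` on `GL_n/F`, `F` CM,
which is L-algebraic with an archimedean exponent of ODD multiplicity at some embedding (hypothesis (i)) and
essentially conjugate self-dual up to `|det|^m` at the Satake level (hypothesis (ii)) is, for every `ℓ`,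
`ι : ℚ̄_ℓ ≃ ℂ` and finite `S₀`, an `ℓ`-ADIC LIMIT, uniformly at every unramified place outside a finite `S ⊇ S₀`, of
REGULAR L-algebraic CUSPIDAL `π'_m` (coefficientwise on the arithmetic-Frobenius polynomials
`arithFrobPolyOfSatake ι q_v 1 ·`, precision `ℓ^{-m}`).

The route's own Layer-2 plan for this crux is OCCURRENCE + DENSITY on a unitary host ("once unitary-group /
eigenvariety vocabulary exists in Literature"). Unitary-group vocabulary now exists
(`Literature/NumberTheory/Automorphic/UnitaryGroupAutomorphicRep.lean`, `…/UnitaryGroupLimitOfDiscreteSeriesAt.lean`,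
`…/MokWeakBaseChange.lean`); unitary EIGENVARIETY vocabulary does not (the `GL_n` interface `Eigenvariety` carries no
existence, so "∃ E, occurrence ∧ density" over it is vacuous — rejected as costume). The line `birth` therefore cuts
the crux along the three functorial joints of the mechanism (Mok descent → p-adic accumulation ON THE UNITARY GROUP →
base change back), each a closed statement over tree vocabulary, with the twist between `π` and the standard base
change of its host carried by an explicit Hecke character `χ`:

* HOST. `(χ, σ, S_H)` is a *twisted unitary host* of `π`: `σ` is a CUSPIDAL automorphic representation of Mok's
  quasi-split unitary group `U_{F/F⁺}(n)` (`F⁺ = maximalRealSubfield F`, involution `IsCMField.complexConj F`),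
  `S_H` is a finite set of finite places of `F` containing every place ramified over `ℚ` and every place where `χ`
  ramifies, and at every `w ∉ S_H` where `π` has Satake parameter `α`, `σ` has (hyperspecial-unramified) base-change
  Satake parameter `α · χ(ϖ_w)` (`UnitaryGroup.HasBaseChangeSatakeAt`), i.e. `BC_{ξ₁}(σ) ≃ π ⊗ (χ ∘ det)` outside
  `S_H`.
* `stub_unitaryDescent` — **DESCEND** (in print; XL as formalisation): every `π` in the sector (`n ≥ 1`) has a twisted
  unitary host. Mok 2015, Thm. 2.4.2 + Thm. 2.5.2 (descent of conjugate self-dual cuspidal representations with the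
  standard sign to the quasi-split unitary group), the sign being FORCED by hypothesis (i): at the embedding with an
  odd-multiplicity exponent the conjugate-dual pairing on the archimedean parameter cannot be symplectic on that
  isotypic piece, which pins the global sign (the mechanism of Fakhruddin–Pilloni 2021, Thm. 9.7, beyond the weakly
  regular case) once `χ` (a half-integral power of the norm times, if needed, a conjugate-symplectic character) has
  made `π ⊗ χ` conjugate self-dual of C-algebraic type.
* `stub_regularCuspidalAccumulation` — **ACCUMULATE on the unitary group** (the HEART; open): given a twisted unitary
  host of `π`, for every `ℓ, ι, S₀` there is a finite `S ⊇ S₀` such that for every `m` some CUSPIDAL `σ'_m` on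
  `U_{F/F⁺}(n)` with REGULAR DISCRETE SERIES at every real place of `F⁺`, admitting a CUSPIDAL weak base change to
  `GL_n/F` (stability witness), is hyperspecial-unramified at every `v ∉ S` where `π` is unramified, with base-change
  parameters `β` whose UNTWISTED polynomials `arithFrobPolyOfSatake ι q_v 1 (β · χ(ϖ_v)⁻¹)` are coefficientwise within
  `ℓ^{-m}` of those of `π`. This is "the eigensystem of `σ` is an `ℓ`-adic limit of stable regular-discrete-series
  eigensystems at fixed tame level" — the statement p-adic families on unitary Shimura varieties / definite unitary
  groups are built to prove (Boxer–Pilloni higher Coleman theory at the singular weight `ν(λ)`, density of classical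
  regular points; Chenevier's eigenvarieties), now in the DEGENERATE-limit / non-LDS sector where no classical
  realisation exists. `Literature.Barriers.Langlands.NonRegularWeightBarrier` is located here, not evaded.
* `stub_twistedStrongBaseChange` — **ASCEND** (in print; L/XL as formalisation): for a twisted unitary host
  `(χ, σ, S_H)` of `π`, a cuspidal `σ'` on `U_{F/F⁺}(n)` with regular discrete series at every real place and a
  cuspidal weak base change `P`, there is a CUSPIDAL `π'` on `GL_n/F` with an L-ALGEBRAIC REGULAR infinity type whose
  Satake parameter at EVERY `v ∉ S_H` where `σ'` has base-change parameter `β` is `β · χ(ϖ_v)⁻¹` (`π' = P ⊗ (χ ∘ det)⁻¹`: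
  Mok 2015 Thm. 2.5.2 at ALL places + Jacquet–Shalika, the twist of a cusp form, and the Buzzard–Gee/Clozel
  normalisation — `P` is C-algebraic regular as the base change of regular discrete series, and `χ_∞` has exponents in
  `(n-1)/2 + ℤ` because `π` is L-algebraic with an odd multiplicity and `π ⊗ χ` lies in the standard base-change image).
* `CongruencesToRegular_of` — the composition, kernel-checked, concluding the route decl BY NAME: DESCEND, ACCUMULATE
  (with `S₀ ∪ S_H`), ASCEND each approximant, read off the crux; the rank `n = 0` is settled inside the proof
  (`π' = π`, empty infinity type, distance `0`).

Disproof used: none on file (`ledger crux ls stmt-Langlands-2629`: no `Disproof.lean`, no `Negative/` lemma, no crux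
idea, 2026-08-17). Negatives index: no stub is a refuted statement; the rank-`0` degeneracy is excluded from every stub
(`0 < n`) and proved outright in the composition.

Shape (for `ledger skeleton check`): stubs `theorem stub_<name> : <signature> := by sorry` stated over tree declarations
only (fully qualified, as in the route file); `_Goal.stub_<name> : Prop := type_of% @stub_<name>` names each statement;
`CongruencesToRegular_of (hD : _Goal.stub_unitaryDescent) (hA : _Goal.stub_regularCuspidalAccumulation)
(hB : _Goal.stub_twistedStrongBaseChange) : CongruencesToRegular` is proved without `sorry`.
-/

set_option linter.dupNamespace false
set_option linter.unusedVariables false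

noncomputable section

namespace Summit.Langlands.Langlands.Cruxes.CongruencesToRegular.Birth

open Summit.Langlands.Langlands.Theses.DegenerateLimits

/-! ## 1. The three stubs -/

/-- **STUB 1 — DESCEND: every `π` in the sector has a twisted unitary host (in print; XL).**
For `F` CM, `n ≥ 1` and a cuspidal `π` on `GL_n(𝔸_F)` satisfying the crux hypotheses (i) (L-algebraic infinity type with an
exponent of odd multiplicity at some embedding) and (ii) (essentially conjugate self-dual up to `|det|^m` on Satake
parameters), there are a Hecke character `χ` of `F`, a CUSPIDAL automorphic representation `σ` of Mok's quasi-split unitary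
group `U_{F/F⁺}(n)` (`F⁺` the maximal real subfield, involution the complex conjugation of `F`) and a finite set `S_H` of
finite places of `F` such that every `w ∉ S_H` is unramified over `ℚ`, `χ` is unramified at `w`, and whenever `π` has Satake
parameter `α` at `w`, `σ` has base-change Satake parameter `α · χ(ϖ_w)` at `w` — i.e. `BC_{ξ₁}(σ) ≃ π ⊗ (χ ∘ det)` outside
`S_H`. Content: `χ = |·|^{-m/2} · χ₋^ε` makes `π ⊗ χ` conjugate self-dual of C-algebraic type; hypothesis (i) forces its
global sign to be the standard one (no symplectic pairing on an odd-multiplicity isotypic piece of the archimedean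
parameter — the mechanism of Fakhruddin–Pilloni's Thm. 9.7, valid for every multiplicity pattern with an odd entry); Mok's
descent then gives a cuspidal (generic parameter) `σ` with `c(π ⊗ χ) = ξ₁(c(σ))`, at every unramified place by the local
classification. `S_H` = places ramified over `ℚ` ∪ ramification of `χ` ∪ the exceptional set of the weak base change.
[cite: Mok2014, Thm. 2.4.2, Thm. 2.5.2, Thm. 2.5.4 (a), Remark 2.5.5]
[cite: FakhruddinPilloni2021, §9.1, Thm. 9.7 (oddness from an odd multiplicity) and Rem. 9.2]
[cite: Minguez2011, Thm. 4.1 (unramified base change on Satake parameters)] -/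
theorem stub_unitaryDescent :
    ∀ (F : Type) [Field F] [NumberField F] [NumberField.IsCMField F] (n : ℕ)
      (hcpt : Literature.NumberTheory.Automorphic.isCompact_glFiniteIntegralLevel n F)
      (π : Literature.NumberTheory.Automorphic.CuspidalAutomorphicRepData n F hcpt), 0 < n →
      (∃ T : Literature.NumberTheory.Automorphic.InfinityType F n, π.1.HasInfinityType T ∧ T.IsLAlgebraic ∧
        ∃ (σ : F →+* ℂ) (a : ℂ), Odd (((T σ).map Literature.NumberTheory.Automorphic.ArchWeight.a).count a)) →
      (∃ m : ℤ, ∀ᶠ v : IsDedekindDomain.HeightOneSpectrum (NumberField.RingOfIntegers F) in Filter.cofinite,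
        ∀ α β : Multiset ℂ, π.1.HasSatakeParamAt v α →
          π.1.HasSatakeParamAt (IsDedekindDomain.HeightOneSpectrum.equivOfRingEquiv
            (NumberField.IsCMField.ringOfIntegersComplexConj F).toRingEquiv v) β →
            β = α.map (fun a ↦ a⁻¹ * (v.residueCard : ℂ) ^ (-m))) →
      ∃ (χ : Literature.NumberTheory.GaloisRepresentations.HeckeCharacter F)
        (σ : Literature.NumberTheory.Automorphic.UnitaryGroup.CuspidalAutomorphicRepData
          (NumberField.maximalRealSubfield F) F (NumberField.IsCMField.complexConj F) n hcpt)
        (S_H : Set (IsDedekindDomain.HeightOneSpectrum (NumberField.RingOfIntegers F))),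
        S_H.Finite ∧ ∀ w ∉ S_H, w.asIdeal.ramificationIdx ℤ = 1 ∧ χ.IsUnramifiedAt w ∧
          ∀ α : Multiset ℂ, π.1.HasSatakeParamAt w α →
            Literature.NumberTheory.Automorphic.UnitaryGroup.HasBaseChangeSatakeAt
              (NumberField.maximalRealSubfield F) F (NumberField.IsCMField.complexConj F) n hcpt σ.1 w
              (α.map (fun a ↦ a * χ.valueAtUniformizer w)) := by
  sorry

/-- **STUB 2 — ACCUMULATE on the unitary group (the HEART; open).**
Let `(χ, σ, S_H)` be a twisted unitary host of `π` (as produced by `stub_unitaryDescent`; `π` cuspidal on `GL_n/F`, `F` CM,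
`n ≥ 1`, hypothesis (i)). Then for every prime `ℓ`, `ι : ℚ̄_ℓ ≃ ℂ` and finite `S₀` there is a finite `S ⊇ S₀` such that for
every `m` there is a CUSPIDAL `σ'` on `U_{F/F⁺}(n)` with (a) REGULAR discrete series at every real place of `F⁺`
(`d.IsRegular ∧ IsLimitOfDiscreteSeriesAt … d` at every complex place of `F`, all of which are fixed by the complex
conjugation), (b) a CUSPIDAL weak base change `P` to `GL_n/F` (stability: `σ'` is not endoscopic), and (c) at every `v ∉ S`
where `π` has Satake parameter `α`, a base-change Satake parameter `β` whose untwisted arithmetic-Frobenius polynomial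
`arithFrobPolyOfSatake ι q_v 1 (β · χ(ϖ_v)⁻¹)` is coefficientwise within `ℓ^{-m}` of `arithFrobPolyOfSatake ι q_v 1 α`.
In words: at fixed tame level, the (twisted) Hecke eigensystem of `σ` is an `ℓ`-adic limit of eigensystems of STABLE cuspidal
representations with REGULAR DISCRETE SERIES at infinity. MECHANISM (the route's): realise the finite-slope eigensystem of
`σ` as a point `x₀` of a unitary eigenvariety at the singular `p`-adic weight (Boxer–Pilloni's `H^i_{w,an}(K^p, ν)^{fs}`,
interior eigenvariety `∪_w E_w^!`, or Chenevier's definite `U(n)` eigenvariety via `p`-adic Jacquet–Langlands), where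
classical regular points are dense and the stable locus is open near a point whose base change is cuspidal; weight-one
forms on eigencurves are the model. Why it might fail: nothing is known to force a non-cohomological (degenerate-limit /
non-LDS tempered) eigensystem into a `p`-adic family; approximants could be forced endoscopic.
`Literature.Barriers.Langlands.NonRegularWeightBarrier` is located in this stub (not evaded).
[cite: BoxerPilloni2021HigherColeman, Rem. 17, Thm. 18, Rem. 20, Thm. 346 (density), Thm. 351]
[cite: FakhruddinPilloni2021, Thm. 9.10 (the weakly-regular odd case: "p-adic limit of regular eigensystems")]
[cite: Chenevier2004, §4 and §7 (definite unitary eigenvarieties; p-adic Jacquet–Langlands for weight one)]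
[cite: GoldringKoskivirta2019, Thm. 3.4.1, §11.1 (regular shadows, non-degenerate LDS case)]
[cite: NewtonThorneIHES2021a, §2.1, Lemma 21 (singular functorial points on unitary eigenvarieties)] -/
theorem stub_regularCuspidalAccumulation :
    ∀ (F : Type) [Field F] [NumberField F] [NumberField.IsCMField F] (n : ℕ)
      (hcpt : Literature.NumberTheory.Automorphic.isCompact_glFiniteIntegralLevel n F)
      (π : Literature.NumberTheory.Automorphic.CuspidalAutomorphicRepData n F hcpt), 0 < n →
      (∃ T : Literature.NumberTheory.Automorphic.InfinityType F n, π.1.HasInfinityType T ∧ T.IsLAlgebraic ∧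
        ∃ (σ : F →+* ℂ) (a : ℂ), Odd (((T σ).map Literature.NumberTheory.Automorphic.ArchWeight.a).count a)) →
      ∀ (χ : Literature.NumberTheory.GaloisRepresentations.HeckeCharacter F)
        (σ : Literature.NumberTheory.Automorphic.UnitaryGroup.CuspidalAutomorphicRepData
          (NumberField.maximalRealSubfield F) F (NumberField.IsCMField.complexConj F) n hcpt)
        (S_H : Set (IsDedekindDomain.HeightOneSpectrum (NumberField.RingOfIntegers F))),
        (S_H.Finite ∧ ∀ w ∉ S_H, w.asIdeal.ramificationIdx ℤ = 1 ∧ χ.IsUnramifiedAt w ∧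
          ∀ α : Multiset ℂ, π.1.HasSatakeParamAt w α →
            Literature.NumberTheory.Automorphic.UnitaryGroup.HasBaseChangeSatakeAt
              (NumberField.maximalRealSubfield F) F (NumberField.IsCMField.complexConj F) n hcpt σ.1 w
              (α.map (fun a ↦ a * χ.valueAtUniformizer w))) →
      ∀ (ℓ : ℕ) [Fact ℓ.Prime] (ι : PadicAlgCl ℓ ≃+* ℂ)
        (S₀ : Set (IsDedekindDomain.HeightOneSpectrum (NumberField.RingOfIntegers F))), S₀.Finite →
        ∃ S : Set (IsDedekindDomain.HeightOneSpectrum (NumberField.RingOfIntegers F)), S₀ ⊆ S ∧ S.Finite ∧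
          ∀ m : ℕ, ∃ σ' : Literature.NumberTheory.Automorphic.UnitaryGroup.CuspidalAutomorphicRepData
              (NumberField.maximalRealSubfield F) F (NumberField.IsCMField.complexConj F) n hcpt,
            (∀ (w : {w : NumberField.InfinitePlace F // w.IsComplex})
                (hw : NumberField.IsCMField.complexConj F • w.1 = w.1),
                ∃ (p q : ℕ) (d : Literature.NumberTheory.Automorphic.LDSDatum p q), d.IsRegular ∧
                  Literature.NumberTheory.Automorphic.UnitaryGroup.IsLimitOfDiscreteSeriesAt
                    (NumberField.maximalRealSubfield F) F (NumberField.IsCMField.complexConj F) n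
                    (Literature.NumberTheory.Automorphic.StdForm.antidiagonal n) hcpt σ'.1 hw
                    (NumberField.IsCMField.complexConj_ne_one F) d) ∧
            (∃ P : Literature.NumberTheory.Automorphic.CuspidalAutomorphicRepData n F hcpt,
                Literature.NumberTheory.Automorphic.UnitaryGroup.IsWeakBaseChange
                  (NumberField.maximalRealSubfield F) F (NumberField.IsCMField.complexConj F) n hcpt P.1 σ'.1) ∧
            ∀ v ∉ S, ∀ α : Multiset ℂ, π.1.HasSatakeParamAt v α →
              ∃ β : Multiset ℂ,
                Literature.NumberTheory.Automorphic.UnitaryGroup.HasBaseChangeSatakeAt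
                  (NumberField.maximalRealSubfield F) F (NumberField.IsCMField.complexConj F) n hcpt σ'.1 v β ∧
                ∀ k : ℕ, ‖(Literature.NumberTheory.Automorphic.arithFrobPolyOfSatake ι v.residueCard 1
                      (β.map (fun b ↦ b * (χ.valueAtUniformizer v)⁻¹))).coeff k -
                    (Literature.NumberTheory.Automorphic.arithFrobPolyOfSatake ι v.residueCard 1 α).coeff k‖ ≤
                  (ℓ : ℝ) ^ (-(m : ℤ)) := by
  sorry

/-- **STUB 3 — ASCEND: twisted strong base change of stable regular-discrete-series forms (in print; L/XL).**
Let `(χ, σ, S_H)` be a twisted unitary host of `π` (`π` cuspidal on `GL_n/F`, `F` CM, `n ≥ 1`, hypothesis (i)), `σ'` a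
CUSPIDAL automorphic representation of `U_{F/F⁺}(n)` with REGULAR discrete series at every real place, and `P` a CUSPIDAL
weak base change of `σ'` to `GL_n/F`. Then there is a CUSPIDAL `π'` on `GL_n(𝔸_F)` with an L-ALGEBRAIC REGULAR infinity type
such that at EVERY `v ∉ S_H` where `σ'` has base-change Satake parameter `β`, `π'` has Satake parameter `β · χ(ϖ_v)⁻¹`.
Content (`π' = P ⊗ (χ ∘ det)⁻¹`): `P` cuspidal and a weak base change ⇒ `P = π_{ψ^N}` is the base change at EVERY place
(Mok's Thm. 2.5.2 with the local classification; Jacquet–Shalika), so `P_v` is unramified with Satake parameter `β` at every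
hyperspecial-unramified `v` unramified over `ℚ` (`v ∉ S_H`), and `P_∞ = BC(σ'_∞)` is C-ALGEBRAIC REGULAR (Harish-Chandra
parameter `λ ∈ ρ + X*` regular ⇒ exponents `±λ_i ∈ (n-1)/2 + ℤ`, distinct); `χ` unramified at `v ∉ S_H` multiplies Satake
parameters by `χ(ϖ_v)` (Arthur–Clozel), twists of cusp forms are cusp forms, and `χ_∞` has exponents in `(n-1)/2 + ℤ` — from
the host relation: `π ⊗ χ ≃ BC(σ)` is conjugate self-dual of the standard sign `(-1)^{n-1}` while `π` is L-algebraic with an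
odd-multiplicity exponent, so `2 s_τ ≡ n - 1 (mod 2)` at that embedding and at all others by constancy of parity — hence
`π'` is L-algebraic regular (Buzzard–Gee's half-twist). `v ∉ S_H` guarantees `v` unramified over `ℚ` (no junk use of the
hyperspecial predicate) and `χ` unramified at `v`.
[cite: Mok2014, Thm. 2.5.2, Cor. 4.3.8, §2.3 (strong multiplicity one for the parameter)]
[cite: Minguez2011, Thm. 4.1] [cite: Clozel1990, Déf. 1.8, 3.12, Lemme 3.14 (regular algebraic = cohomological)]
[cite: BuzzardGee2014, §5.3 after Def. 5.3.3 (C ↔ L by |det|^{(n-1)/2})]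
[cite: HarrisLanTaylorThorneRMS2016, §1.3 (BC(Π)_w at unramified places)] -/
theorem stub_twistedStrongBaseChange :
    ∀ (F : Type) [Field F] [NumberField F] [NumberField.IsCMField F] (n : ℕ)
      (hcpt : Literature.NumberTheory.Automorphic.isCompact_glFiniteIntegralLevel n F)
      (π : Literature.NumberTheory.Automorphic.CuspidalAutomorphicRepData n F hcpt), 0 < n →
      (∃ T : Literature.NumberTheory.Automorphic.InfinityType F n, π.1.HasInfinityType T ∧ T.IsLAlgebraic ∧
        ∃ (σ : F →+* ℂ) (a : ℂ), Odd (((T σ).map Literature.NumberTheory.Automorphic.ArchWeight.a).count a)) →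
      ∀ (χ : Literature.NumberTheory.GaloisRepresentations.HeckeCharacter F)
        (σ : Literature.NumberTheory.Automorphic.UnitaryGroup.CuspidalAutomorphicRepData
          (NumberField.maximalRealSubfield F) F (NumberField.IsCMField.complexConj F) n hcpt)
        (S_H : Set (IsDedekindDomain.HeightOneSpectrum (NumberField.RingOfIntegers F))),
        (S_H.Finite ∧ ∀ w ∉ S_H, w.asIdeal.ramificationIdx ℤ = 1 ∧ χ.IsUnramifiedAt w ∧
          ∀ α : Multiset ℂ, π.1.HasSatakeParamAt w α →
            Literature.NumberTheory.Automorphic.UnitaryGroup.HasBaseChangeSatakeAt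
              (NumberField.maximalRealSubfield F) F (NumberField.IsCMField.complexConj F) n hcpt σ.1 w
              (α.map (fun a ↦ a * χ.valueAtUniformizer w))) →
      ∀ (σ' : Literature.NumberTheory.Automorphic.UnitaryGroup.CuspidalAutomorphicRepData
          (NumberField.maximalRealSubfield F) F (NumberField.IsCMField.complexConj F) n hcpt),
        (∀ (w : {w : NumberField.InfinitePlace F // w.IsComplex})
            (hw : NumberField.IsCMField.complexConj F • w.1 = w.1),
            ∃ (p q : ℕ) (d : Literature.NumberTheory.Automorphic.LDSDatum p q), d.IsRegular ∧
              Literature.NumberTheory.Automorphic.UnitaryGroup.IsLimitOfDiscreteSeriesAt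
                (NumberField.maximalRealSubfield F) F (NumberField.IsCMField.complexConj F) n
                (Literature.NumberTheory.Automorphic.StdForm.antidiagonal n) hcpt σ'.1 hw
                (NumberField.IsCMField.complexConj_ne_one F) d) →
        ∀ (P : Literature.NumberTheory.Automorphic.CuspidalAutomorphicRepData n F hcpt),
          Literature.NumberTheory.Automorphic.UnitaryGroup.IsWeakBaseChange
            (NumberField.maximalRealSubfield F) F (NumberField.IsCMField.complexConj F) n hcpt P.1 σ'.1 →
          ∃ π' : Literature.NumberTheory.Automorphic.CuspidalAutomorphicRepData n F hcpt,
            (∃ T' : Literature.NumberTheory.Automorphic.InfinityType F n,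
                π'.1.HasInfinityType T' ∧ T'.IsLAlgebraic ∧ T'.IsRegular) ∧
            ∀ v ∉ S_H, ∀ β : Multiset ℂ,
              Literature.NumberTheory.Automorphic.UnitaryGroup.HasBaseChangeSatakeAt
                (NumberField.maximalRealSubfield F) F (NumberField.IsCMField.complexConj F) n hcpt σ'.1 v β →
              π'.1.HasSatakeParamAt v (β.map (fun b ↦ b * (χ.valueAtUniformizer v)⁻¹)) := by
  sorry

/-! ## 2. The stub statements as named `Prop`s (literally their types) -/

namespace _Goal

/-- The statement of `stub_unitaryDescent`, as a named `Prop` (literally its type). [folklore] -/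
def stub_unitaryDescent : Prop :=
  type_of% @Summit.Langlands.Langlands.Cruxes.CongruencesToRegular.Birth.stub_unitaryDescent

/-- The statement of `stub_regularCuspidalAccumulation`, as a named `Prop` (literally its type). [folklore] -/
def stub_regularCuspidalAccumulation : Prop :=
  type_of% @Summit.Langlands.Langlands.Cruxes.CongruencesToRegular.Birth.stub_regularCuspidalAccumulation

/-- The statement of `stub_twistedStrongBaseChange`, as a named `Prop` (literally its type). [folklore] -/
def stub_twistedStrongBaseChange : Prop :=
  type_of% @Summit.Langlands.Langlands.Cruxes.CongruencesToRegular.Birth.stub_twistedStrongBaseChange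

end _Goal

/-! ## 3. The composition (kernel-checked, no `sorry`): DESCEND → ACCUMULATE on `U` → ASCEND each approximant -/

/-- **`CongruencesToRegular` from the three stubs.** Given `F, n, π` in the sector and `ℓ, ι, S₀`: for `n = 0` the crux holds
with `π' = π` (the infinity type is empty, hence regular; distance `0`). For `n ≥ 1`: `stub_unitaryDescent` gives a twisted
unitary host `(χ, σ, S_H)`; `stub_regularCuspidalAccumulation`, run with the finite set `S₀ ∪ S_H`, gives a finite
`S ⊇ S₀ ∪ S_H` and, for each `m`, a stable cuspidal `σ'_m` with regular discrete series at infinity whose untwisted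
base-change polynomials are within `ℓ^{-m}` of those of `π` at every `v ∉ S`; `stub_twistedStrongBaseChange` turns `σ'_m` into a
cuspidal L-algebraic regular `π'_m` on `GL_n/F` with exactly those untwisted Satake parameters at every `v ∉ S_H ⊉`, in
particular at every `v ∉ S`. The hypotheses are, by name, the statements of the three stubs; the conclusion is the route
decl `Summit.Langlands.Langlands.Theses.DegenerateLimits.CongruencesToRegular`. [folklore] -/
theorem CongruencesToRegular_of (hD : _Goal.stub_unitaryDescent) (hA : _Goal.stub_regularCuspidalAccumulation)
    (hB : _Goal.stub_twistedStrongBaseChange) :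
    Summit.Langlands.Langlands.Theses.DegenerateLimits.CongruencesToRegular := by
  -- the stub statements, as the Π-types they literally are
  have hD' : type_of% @stub_unitaryDescent := hD
  have hA' : type_of% @stub_regularCuspidalAccumulation := hA
  have hB' : type_of% @stub_twistedStrongBaseChange := hB
  intro F _ _ _ n hcpt π hi hii ℓ _ ι S₀ hS₀
  rcases Nat.eq_zero_or_pos n with hn | hn
  · -- rank `n = 0`: `π` is its own regular approximant
    subst hn
    refine ⟨S₀, fun v hv => hv, hS₀, fun m => ⟨π, ?_, fun v _ α hα => ⟨α, hα, fun k => ?_⟩⟩⟩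
    · obtain ⟨T, hT, hL, -⟩ := hi
      refine ⟨T, hT, hL, fun σ => ?_⟩
      have h0 : T σ = 0 := Multiset.card_eq_zero.mp (hT.1.1 σ)
      rw [h0, Multiset.map_zero]
      exact Multiset.nodup_zero
    · rw [sub_self, norm_zero]
      exact zpow_nonneg (Nat.cast_nonneg _) _
  · -- DESCEND: a twisted unitary host `(χ, σ, S_H)` of `π`
    obtain ⟨χ, σ, S_H, hhost⟩ := hD' F n hcpt π hn hi hii
    -- ACCUMULATE on `U_{F/F⁺}(n)`, outside the finite set `S₀ ∪ S_H`
    obtain ⟨S, hS₀S, hSfin, hS⟩ :=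
      hA' F n hcpt π hn hi χ σ S_H hhost ℓ ι (S₀ ∪ S_H) (hS₀.union hhost.1)
    refine ⟨S, fun v hv => hS₀S (Set.mem_union_left S_H hv), hSfin, fun m => ?_⟩
    obtain ⟨σ', hDS, ⟨P, hP⟩, hclose⟩ := hS m
    -- ASCEND the approximant: a cuspidal L-algebraic regular `π'` with the untwisted Satake parameters
    obtain ⟨π', hT', hmatch⟩ := hB' F n hcpt π hn hi χ σ S_H hhost σ' hDS P hP
    refine ⟨π', hT', fun v hv α hα => ?_⟩
    obtain ⟨β, hβ, hc⟩ := hclose v hv α hα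
    exact ⟨β.map (fun b ↦ b * (χ.valueAtUniformizer v)⁻¹),
      hmatch v (fun h => hv (hS₀S (Set.mem_union_right S₀ h))) β hβ, hc⟩

/-- By-name sanity check (an `example`, not a declaration of the file): the three stubs feed the composition as they
stand. -/
example : Summit.Langlands.Langlands.Theses.DegenerateLimits.CongruencesToRegular :=
  CongruencesToRegular_of stub_unitaryDescent stub_regularCuspidalAccumulation stub_twistedStrongBaseChange

end Summit.Langlands.Langlands.Cruxes.CongruencesToRegular.Birth

end
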